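import Literature.NumberTheory.LFunctions.DeBruijnHDiv
import Literature.NumberTheory.LFunctions.DeBruijnNewmanConstProofs
import Literature.Analysis.Complex.DeBruijnUniversalFactorsProofs
import HarnessLib

/-!
# `deBruijnHDiv m` is a real entire function of order `< 2` for continuous multipliers `m ≥ 1`

Trunk T-NT support (`Literature/NumberTheory/LFunctions`), continuing `DeBruijnHDiv.lean`.

With `Φ = deBruijnPhi` and `deBruijnHDiv m z = ∫₀^∞ (Φ(u)/m(u)) cos(zu) du` (the de Bruijn transform
of `Φ` DIVIDED by a kernel multiplier), we prove, for every CONTINUOUS `m ≥ 1` — the class containing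
all finite universal factors `e^{tu²} ∏ (1 + u²/b²)`, `t ≥ 0`, in particular the Laplace multiplier
`1 + u²/a²` of route `RiemannHypothesis/UniversalFactor` —:

* `isAdmissible_divKernel`, `trigIntegral_divKernel`: the even kernel `Φ(|s|)/m(|s|)` is de
  Bruijn-admissible (dominated by `F_0(s) = Φ(|s|)`) and `∫ℝ Φ(|s|)/m(|s|) e^{izs} ds = 2 deBruijnHDiv m z`;
* `exists_growth_deBruijnHDiv_of_one_le` — **de Bruijn 1950, Thm. 10** for these kernels:
  `‖deBruijnHDiv m z‖ ≤ C e^{‖z‖^ρ}` for some `0 ≤ ρ < 2`;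
* `deBruijnHDiv_zero_ne_zero_of_one_le`: `deBruijnHDiv m 0 = ∫₀^∞ Φ/m > 0`;
* the Laplace specialisations `exists_growth_deBruijnHDiv_laplaceMultiplier`,
  `deBruijnHDiv_laplaceMultiplier_zero_ne_zero`.

These are the route-independent forms of lemmas first landed in
`Summits/RiemannHypothesis/RiemannHypothesis/Theorems/UniversalFactorLaguerreLift.lean` and
`…/UniversalFactorMixedFactorReduction.lean`; those modules import the route's `Theses` file, so
the gate cannot link them from it (import cycle), whence this Theses-free home next to the
definition of `deBruijnHDiv`.

References: N. G. de Bruijn, *The roots of trigonometric integrals*, Duke Math. J. 17 (1950),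
197–226, Thm. 10.
-/

noncomputable section

namespace Literature.NumberTheory.LFunctions

open MeasureTheory Set Filter
open Literature.Analysis.Complex

/-! ## Multipliers `m ≥ 1`: admissibility of the kernel `Φ(|s|)/m(|s|)` -/

/-- A continuous multiplier `m ≥ 1` is `IsDivAdmissible` (with `C = 1`, `T = 0`). [folklore] -/
theorem isDivAdmissible_of_one_le {m : ℝ → ℝ} (hmc : Continuous m) (hm1 : ∀ u, 1 ≤ m u) :
    IsDivAdmissible m := by
  refine ⟨hmc.aestronglyMeasurable, 1, 0, zero_le_one, fun u _ ↦ ?_⟩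
  rw [abs_of_pos (by linarith [hm1 u]), zero_mul, Real.exp_zero, mul_one]
  exact inv_le_one_of_one_le₀ (hm1 u)

/-- Pointwise domination of the kernel `Φ(|s|)/m(|s|)` by de Bruijn's kernel `F_0(s) = Φ(|s|)` when
`m ≥ 1`. [folklore] -/
theorem norm_divKernel_le_deBruijnKernel {m : ℝ → ℝ} (hm1 : ∀ u, 1 ≤ m u) (s : ℝ) :
    ‖(((Newman.evenPhi s / m |s| : ℝ) : ℂ))‖ ≤ ‖deBruijnKernel 0 s‖ := by
  have hm_pos : 0 < m |s| := by linarith [hm1 |s|]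
  rw [norm_deBruijnKernel, zero_mul, Real.exp_zero, one_mul, Complex.norm_real, Real.norm_eq_abs,
    abs_of_nonneg (div_nonneg (Newman.evenPhi_nonneg s) hm_pos.le)]
  exact div_le_self (Newman.evenPhi_nonneg s) (hm1 _)

/-- **The kernel `Φ(|s|)/m(|s|)` is de Bruijn-admissible** for continuous `m ≥ 1` (integrable,
`K(−s) = K(s)^*` — it is real and even —, and `K(s) = O(e^{−|s|³})`), being dominated by the
admissible kernel `F_0`. [cite: Bruijn1950, Thm. 10] -/
theorem isAdmissible_divKernel {m : ℝ → ℝ} (hmc : Continuous m) (hm1 : ∀ u, 1 ≤ m u) :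
    DeBruijn1950.IsAdmissible (fun s : ℝ ↦ ((Newman.evenPhi s / m |s| : ℝ) : ℂ)) := by
  have hm_pos : ∀ s : ℝ, 0 < m s := fun s ↦ by linarith [hm1 s]
  have hcont : Continuous fun s : ℝ ↦ ((Newman.evenPhi s / m |s| : ℝ) : ℂ) :=
    Complex.continuous_ofReal.comp
      (Newman.continuous_evenPhi.div (hmc.comp continuous_abs) fun s ↦ (hm_pos _).ne')
  obtain ⟨C, hC, hle⟩ := exists_norm_deBruijnKernel_le 0
  refine ⟨?_, fun s ↦ ?_, ⟨3, C, by norm_num, Eventually.of_forall fun s ↦ ?_⟩⟩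
  · exact (integrable_deBruijnKernel 0).norm.mono' hcont.aestronglyMeasurable
      (Eventually.of_forall fun s ↦ norm_divKernel_le_deBruijnKernel hm1 s)
  · simp only [Newman.evenPhi_neg, abs_neg, Complex.conj_ofReal]
  · have h1 : Real.exp (-|s|) ≤ 1 := Real.exp_le_one_iff.2 (neg_nonpos.2 (abs_nonneg s))
    calc ‖(((Newman.evenPhi s / m |s| : ℝ) : ℂ))‖ ≤ ‖deBruijnKernel 0 s‖ :=
          norm_divKernel_le_deBruijnKernel hm1 s
      _ ≤ C * Real.exp (-|s|) * Real.exp (-|s| ^ 3) := hle s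
      _ ≤ C * 1 * Real.exp (-|s| ^ 3) :=
          mul_le_mul_of_nonneg_right (mul_le_mul_of_nonneg_left h1 hC) (Real.exp_pos _).le
      _ = C * Real.exp (-|s| ^ (3 : ℝ)) := by
          rw [mul_one, show (3 : ℝ) = ((3 : ℕ) : ℝ) by norm_num, Real.rpow_natCast]

/-- **`∫_ℝ Φ(|s|)/m(|s|) e^{izs} ds = 2 · deBruijnHDiv m z`**: the divided transform as a de Bruijn
trigonometric integral (fold `ℝ` onto `(0, ∞)`, `e^{izs} + e^{−izs} = 2cos(zs)`). [folklore] -/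
theorem trigIntegral_divKernel {m : ℝ → ℝ} (hmc : Continuous m) (hm1 : ∀ u, 1 ≤ m u) (z : ℂ) :
    trigIntegral (fun s : ℝ ↦ ((Newman.evenPhi s / m |s| : ℝ) : ℂ)) z =
      2 * deBruijnHDiv m z := by
  have hF := isAdmissible_divKernel hmc hm1
  set k : ℝ → ℂ := fun s ↦ ((Newman.evenPhi s / m |s| : ℝ) : ℂ) *
    Complex.exp (Complex.I * z * s) with hk
  have hki : Integrable k :=
    integrable_mul_cexp_of_exp_moment hF.integrable.aestronglyMeasurable z
      (hF.integrable_norm_mul_exp ‖z‖)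
  have h1 : trigIntegral (fun s : ℝ ↦ ((Newman.evenPhi s / m |s| : ℝ) : ℂ)) z =
      (∫ s in Iic (0 : ℝ), k s) + ∫ s in Ioi (0 : ℝ), k s := by
    rw [trigIntegral,
      intervalIntegral.integral_Iic_add_Ioi hki.integrableOn hki.integrableOn]
  have h2 : ∫ s in Iic (0 : ℝ), k s = ∫ s in Ioi (0 : ℝ), k (-s) := by
    rw [integral_comp_neg_Ioi, neg_zero]
  have hki' : IntegrableOn (fun s ↦ k (-s)) (Ioi 0) := hki.comp_neg.integrableOn
  rw [h1, h2, ← integral_add hki' hki.integrableOn, deBruijnHDiv, ← integral_const_mul]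
  refine setIntegral_congr_fun measurableSet_Ioi fun s (hs : 0 < s) ↦ ?_
  have hcos : Complex.exp (Complex.I * z * ((-s : ℝ) : ℂ)) + Complex.exp (Complex.I * z * s) =
      2 * Complex.cos (z * s) := by
    rw [Complex.two_cos]
    push_cast
    ring_nf
  simp only [hk]
  rw [Newman.evenPhi_neg, abs_neg, ← mul_add, hcos, Newman.evenPhi_of_nonneg hs.le, abs_of_pos hs]
  push_cast
  ring

/-! ## Growth of order `< 2`, and non-degeneracy -/

/-- **`deBruijnHDiv m` is a real entire function of order `< 2`** for continuous `m ≥ 1`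
(de Bruijn 1950, Thm. 10, applied to the admissible kernel `Φ(|s|)/m(|s|)`):
`‖deBruijnHDiv m z‖ ≤ C e^{‖z‖^ρ}` with `0 ≤ ρ < 2`. [cite: Bruijn1950, Thm. 10] -/
theorem exists_growth_deBruijnHDiv_of_one_le {m : ℝ → ℝ} (hmc : Continuous m)
    (hm1 : ∀ u, 1 ≤ m u) :
    ∃ ρ C : ℝ, 0 ≤ ρ ∧ ρ < 2 ∧ ∀ z, ‖deBruijnHDiv m z‖ ≤ C * Real.exp (‖z‖ ^ ρ) := by
  obtain ⟨ρ, C₀, hρ0, hρ, h⟩ := (isAdmissible_divKernel hmc hm1).exists_order_bound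
  refine ⟨ρ, C₀ / 2, hρ0, hρ, fun z ↦ ?_⟩
  have h1 := h z
  rw [trigIntegral_divKernel hmc hm1, norm_mul, Complex.norm_two] at h1
  linarith

/-- **Non-degeneracy**: `deBruijnHDiv m 0 = ∫₀^∞ Φ(u)/m(u) du > 0` for continuous `m ≥ 1`
(`Φ > 0`, `m > 0`), so the transform is not identically zero. [folklore] -/
theorem deBruijnHDiv_zero_ne_zero_of_one_le {m : ℝ → ℝ} (hmc : Continuous m)
    (hm1 : ∀ u, 1 ≤ m u) : deBruijnHDiv m 0 ≠ 0 := by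
  have hm_pos : ∀ u, 0 < m u := fun u ↦ by linarith [hm1 u]
  have hintR : IntegrableOn (fun u : ℝ ↦ deBruijnPhi u / m u) (Ioi 0) := by
    refine (integrableOn_deBruijnHBound 0 0).mono' ?_ ?_
    · exact ((continuousOn_deBruijnPhi_Ici.mono Ioi_subset_Ici_self).div hmc.continuousOn
        fun u _ ↦ (hm_pos u).ne').aestronglyMeasurable measurableSet_Ioi
    · refine ae_restrict_of_forall_mem measurableSet_Ioi fun u _ ↦ ?_
      rw [Real.norm_eq_abs, deBruijnHBound, zero_mul, Real.exp_zero, one_mul, zero_mul,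
        Real.exp_zero, mul_one, abs_div, abs_of_pos (hm_pos u)]
      exact div_le_self (abs_nonneg _) (hm1 u)
  have heq : deBruijnHDiv m 0 = ((∫ u in Ioi (0 : ℝ), deBruijnPhi u / m u : ℝ) : ℂ) := by
    rw [deBruijnHDiv, ← integral_complex_ofReal]
    refine setIntegral_congr_fun measurableSet_Ioi fun u _ ↦ ?_
    simp
  rw [heq, Complex.ofReal_ne_zero]
  apply ne_of_gt
  rw [setIntegral_pos_iff_support_of_nonneg_ae
    (ae_restrict_of_forall_mem measurableSet_Ioi fun u hu ↦
      (div_pos (deBruijnPhi_pos_of_nonneg (le_of_lt hu)) (hm_pos u)).le) hintR]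
  have hsupp : Function.support (fun u : ℝ ↦ deBruijnPhi u / m u) ∩ Ioi 0 = Ioi 0 := by
    refine inter_eq_right.2 fun u hu ↦ ?_
    exact (div_pos (deBruijnPhi_pos_of_nonneg (le_of_lt hu)) (hm_pos u)).ne'
  rw [hsupp, Real.volume_Ioi]
  exact ENNReal.zero_lt_top

/-! ## The Laplace multiplier `1 + u²/a²` -/

/-- The Laplace multiplier is continuous. [folklore] -/
theorem continuous_laplaceMultiplier (a : ℝ) : Continuous fun u : ℝ => 1 + u ^ 2 / a ^ 2 := by
  fun_prop

/-- The Laplace multiplier is `≥ 1`. [folklore] -/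
theorem one_le_laplaceMultiplier (a u : ℝ) : 1 ≤ 1 + u ^ 2 / a ^ 2 := by
  have : 0 ≤ u ^ 2 / a ^ 2 := by positivity
  linarith

/-- **`F_a = deBruijnHDiv (1 + u²/a²)` is a real entire function of order `< 2`**, for every real
`a` (de Bruijn 1950, Thm. 10). [cite: Bruijn1950, Thm. 10] -/
theorem exists_growth_deBruijnHDiv_laplaceMultiplier (a : ℝ) :
    ∃ ρ C : ℝ, 0 ≤ ρ ∧ ρ < 2 ∧
      ∀ z, ‖deBruijnHDiv (fun u : ℝ => 1 + u ^ 2 / a ^ 2) z‖ ≤ C * Real.exp (‖z‖ ^ ρ) :=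
  exists_growth_deBruijnHDiv_of_one_le (continuous_laplaceMultiplier a) (one_le_laplaceMultiplier a)

/-- `F_a(0) = ∫₀^∞ Φ(u)/(1 + u²/a²) du ≠ 0`; in particular `F_a ≢ 0`. [folklore] -/
theorem deBruijnHDiv_laplaceMultiplier_zero_ne_zero (a : ℝ) :
    deBruijnHDiv (fun u : ℝ => 1 + u ^ 2 / a ^ 2) 0 ≠ 0 :=
  deBruijnHDiv_zero_ne_zero_of_one_le (continuous_laplaceMultiplier a) (one_le_laplaceMultiplier a)

end Literature.NumberTheory.LFunctions
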